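import Summits.AtomisticToContinuum.Crystallization.Theorems.OverbindingBudgetAffineRunCutSheetNets

/-!
# `OverbindingBudget` / crux `RobustDefectLimitWindows` (stmt-AtomisticToContinuum-31280) — «RunCut» part 22D-β «NO CROSSING»:
# THE POINTWISE CROSSING-EXCLUSION ENGINE

Support file (lens-4 g89; order of record (2c), `ρ₁ = 30`; memo `g89/memo/TWOSHEET-g89.md` §7 = the ENDGAME LEDGER, steps 0–7).
★★ `no_crossing`: inside ONE chart datum on the ball `B(y j, ρ₁ ν_j)` two h-sites `ma`, `mb` within `D ν_j` of the centre whose chart axes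
make an angle with `|cos| ≤ c ≤ 87/250` CANNOT coexist, provided the parametric side conditions
`K·D + 6.71·hi ≤ ρ₁`, `hi ≤ 1.35·lo`, `(M + 1)·D ≤ 38.28·lo`, `(1 − c) K² ≥ 2`, `(1 − c) M² ≥ 1 + c`, `K ≥ 1`
hold for a scale window `lo ν_j ≤ ν_{ma}, ν_{mb} ≤ hi ν_j` (record values `(D, ρ₁, lo, hi, c, K, M) = (13, 30, .888, 1.04, 103/300, 1.746, 1.44)`:
`22.70 + 6.98 ≤ 30`).  The assembly (memo §7):
1. `z` := the in-plane two-plane point of 22D-α `two_plane_inplane` (`x := y j`): on both planes, `‖z − y j‖ ≤ K D ν_j`, `‖z − y m‖ ≤ (M+1) D ν_j`;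
2. `walker_end` (twice): 22D-α `waypoints` + 22B `access` walk each site's sheet to `z` (ONE chain `≤ 59`); 22B `chain_guard` reads the end site
   `a₀` (resp. `b₀`): scale window `0.0203`, axis `0.01534`, height `0.60003 ν`, lateral `0.64 ν` to `z`, `‖z − y a₀‖ ≤ 0.88 ν`;
3. frame `n := N(a₀)` (unit), `q₀ := y a₀`, `n′ := ±n` with `⟪n′, y b₀ − y a₀⟫ ∈ (−2.36 ν_{b₀}, 0]`; tilt `|⟪n′, N(b₀)⟫| ≤ c + 0.0307 ≤ 0.379`;
4. part 22C `steep_straddle` at `b₀`: a fresh 3-step steepest chain `cb` with rises `≥ 0.79 ν`, bonds `≤ 1.0011 ν` and a sign change at `i ≤ 2`;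
   its lateral drift is `≤ 0.62 ν` per step (`drift_sum`);
5. part 22D-α `net_site` from `a₀` towards the PROJECTED straddle sites `V q := y (cb q) − ⟪n, y (cb q) − y a₀⟫ n` (zero heights; first radius
   `≤ 2.12 ν_{a₀}`, spacing `≤ 1.48 ν_{a₀}`; regions `K D + 6.71 hi ≤ ρ₁`): under `cb i`, `cb (i+1)` net sites `a`, `a′` flat to `ν/10`, lateral `≤ (3/4) ν`;
6. `a ≠ cb i` by part 22D-α `axes_apart` (net axes follow `±n` to `1/250`, straddle axes follow `±N(b₀)` to `0.00078`, and `0.9999 > 0.379`);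
7. TREE `…CrossCore.crossing_pair_absurd` with `σ := 1` (Cauchy–Schwarz), `λ = 1.0011`, `ε = 1/10`, `κ = 3/4`: `(1.0011/2 + 0.1)² + 0.5625 < 1`.
[this file: 0 definitions, 8 theorems; imports `…RunCutSheetNets` (part 22D-α) only; standard axioms]
-/

namespace Summit.AtomisticToContinuum.Crystallization.Theorems.OverbindingBudgetAffineRunCutSheetCrossing

open scoped InnerProductSpace
open Literature.Geometry.DiscreteGeometry
open Summit.AtomisticToContinuum.Crystallization.Theorems.OverbindingBudgetAffineCompressedCutEstablish (nearestDist_pos_of_frame)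
open Summit.AtomisticToContinuum.Crystallization.Theorems.OverbindingBudgetAffineRunCutSheetWalkA
  (frame_axis_norm frame_axis_close norm_sign_smul inner_step)
open Summit.AtomisticToContinuum.Crystallization.Theorems.OverbindingBudgetAffineRunCutCrossCore (crossing_pair_absurd)
open Summit.AtomisticToContinuum.Crystallization.Theorems.OverbindingBudgetAffineRunCutSheetHop (site_charts)
open Summit.AtomisticToContinuum.Crystallization.Theorems.OverbindingBudgetAffineRunCutSheetAccess (lat_add_le chain_guard access)
open Summit.AtomisticToContinuum.Crystallization.Theorems.OverbindingBudgetAffineRunCutSheetStraddle (steep_straddle)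
open Summit.AtomisticToContinuum.Crystallization.Theorems.OverbindingBudgetAffineRunCutSheetNets

variable {N : ℕ}
local notation "E3" => EuclideanSpace ℝ (Fin 3)

/-! ## §1 Euclidean glue -/

/-- Tilt transfer through near-axes: if `n` is within `δa` of `±na` and `m` within `δb` of `±nb` (`na`, `m` unit), then
`|⟪n, m⟫| ≤ |⟪na, nb⟫| + δa + δb`. [this file · kind: glue] -/
theorem inner_near_axes {n m na nb : E3} {σa σb δa δb c : ℝ} (hna : ‖na‖ = 1) (hm : ‖m‖ = 1)
    (hσa : σa = 1 ∨ σa = -1) (hσb : σb = 1 ∨ σb = -1) (ha : ‖n - σa • na‖ ≤ δa) (hb : ‖m - σb • nb‖ ≤ δb)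
    (hc : |⟪na, nb⟫_ℝ| ≤ c) : |⟪n, m⟫_ℝ| ≤ c + δa + δb := by
  have e : ⟪n, m⟫_ℝ = ⟪σa • na, σb • nb⟫_ℝ + ⟪σa • na, m - σb • nb⟫_ℝ + ⟪n - σa • na, m⟫_ℝ := by
    rw [inner_sub_right, inner_sub_left]; ring
  have h1 : |⟪σa • na, σb • nb⟫_ℝ| = |⟪na, nb⟫_ℝ| := by
    rw [real_inner_smul_left, real_inner_smul_right, abs_mul, abs_mul]
    rcases hσa with rfl | rfl <;> rcases hσb with rfl | rfl <;> simp
  have hσna : ‖σa • na‖ = 1 := by rw [norm_sign_smul hσa, hna]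
  have h2 : |⟪σa • na, m - σb • nb⟫_ℝ| ≤ δb :=
    (abs_real_inner_le_norm _ _).trans (by rw [hσna, one_mul]; exact hb)
  have h3 : |⟪n - σa • na, m⟫_ℝ| ≤ δa :=
    (abs_real_inner_le_norm _ _).trans (by rw [hm, mul_one]; exact ha)
  have h4 := abs_add_le (⟪σa • na, σb • nb⟫_ℝ + ⟪σa • na, m - σb • nb⟫_ℝ) ⟪n - σa • na, m⟫_ℝ
  rw [e]; linarith [abs_add_le ⟪σa • na, σb • nb⟫_ℝ ⟪σa • na, m - σb • nb⟫_ℝ]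

/-- `‖n − σ na‖ = ‖na − σ n‖` for `σ = ±1`. [this file · kind: glue] -/
theorem axis_flip {n na : E3} {σ d : ℝ} (hσ : σ = 1 ∨ σ = -1) (h : ‖n - σ • na‖ ≤ d) : ‖na - σ • n‖ ≤ d := by
  rcases hσ with rfl | rfl
  · rw [one_smul] at h ⊢; rwa [norm_sub_rev]
  · rw [neg_one_smul, sub_neg_eq_add] at h ⊢; rwa [add_comm]

/-- Lateral drift of a steep chain: three steps with rises `≥ 0.79 ν_s`, lengths `≤ 1.0011 ν_s` and scales `ν_s ≤ 1.0035 ν₀` drift laterally by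
`≤ 0.6222 · s · ν₀` after `s ≤ 3` steps (part 22D-α `lat_le_of_rise`: `0.62 · 1.0035 ≤ 0.6222`). [this file · kind: glue] -/
theorem drift_sum {n : E3} (hn : ‖n‖ = 1) (p : ℕ → E3) (ν : ℕ → ℝ) {ν₀ : ℝ} (hν₀ : 0 ≤ ν₀)
    (hwin : ∀ s, s < 3 → 0 ≤ ν s ∧ ν s ≤ 10035 / 10000 * ν₀)
    (hrise : ∀ s, s < 3 → 79 / 100 * ν s ≤ ⟪n, p (s + 1) - p s⟫_ℝ ∧ ‖p (s + 1) - p s‖ ≤ 10011 / 10000 * ν s) :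
    ∀ s, s ≤ 3 → ‖(p s - p 0) - ⟪n, p s - p 0⟫_ℝ • n‖ ≤ 6222 / 10000 * s * ν₀ := by
  intro s hs
  induction s with
  | zero => simp
  | succ s ih =>
    obtain ⟨hν, hw⟩ := hwin s (by omega)
    obtain ⟨hr, hl⟩ := hrise s (by omega)
    have hstep := lat_le_of_rise hn hν hr hl
    have ih' := ih (by omega)
    rw [show p (s + 1) - p 0 = (p (s + 1) - p s) + (p s - p 0) by abel]
    refine (lat_add_le n _ _).trans ?_
    push_cast
    linarith

section Atlas
/-! ONE chart datum on the ball `B(y j, ρ₁ ν_j)` (verbatim §2 of part 22A). -/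
variable {y : Fin N → E3} (hy : Function.Injective y) {j : Fin N} {ρ₁ : ℝ}
  {Ac : Fin N → (E3 →ₗ[ℝ] E3)} {Qc : Fin N → (E3 →ₗᵢ[ℝ] E3)} {Pc : Fin N → Finset E3} {fc : Fin N → E3 → E3}
  (hP : ∀ i, dist (y i) (y j) ≤ ρ₁ * nearestDist y j → Pc i = fccTwoShellPattern ∨ Pc i = hcpTwoShellPattern)
  (hA : ∀ i, dist (y i) (y j) ≤ ρ₁ * nearestDist y j → ∀ v ∈ Pc i, ‖Ac i v - Qc i v‖ ≤ 1 / 1000)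
  (hf : ∀ i, dist (y i) (y j) ≤ ρ₁ * nearestDist y j → ∀ v ∈ Pc i,
    fc i v ∈ Set.range y ∧ dist (fc i v) (y i + nearestDist y i • Ac i v) ≤ 1 / 10 ^ 4 * nearestDist y i)
  (hinj : ∀ i, dist (y i) (y j) ≤ ρ₁ * nearestDist y j → Set.InjOn (fc i) ↑(Pc i))
  (hex : ∀ i, dist (y i) (y j) ≤ ρ₁ * nearestDist y j → ∀ k : Fin N, k ≠ i →
    dist (y k) (y i) ≤ (3 / 2 + 1 / 450) * nearestDist y i → ∃ v ∈ Pc i, fc i v = y k)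

include hy hP hA hf hinj hex

/-! ## §2 The end site of a walker -/

omit hP in
/-- At an h-site of the ball the normalised chart axis is a unit vector and the scale is positive. [this file · kind: glue] -/
theorem unit_axis {i : Fin N} (hball : dist (y i) (y j) ≤ ρ₁ * nearestDist y j) (hPi : Pc i = hcpTwoShellPattern) :
    ‖(‖Ac i ((Real.sqrt 18)⁻¹ • intVec ![4, 4, 4])‖⁻¹ • Ac i ((Real.sqrt 18)⁻¹ • intVec ![4, 4, 4]) : E3)‖ = 1 ∧
      0 < nearestDist y i := by
  obtain ⟨hA0, hf0, hinj0, -⟩ := site_charts hA hf hinj hex hball hPi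
  obtain ⟨hL', -⟩ := frame_axis_norm (frame_axis_close hA0)
  have hne : ‖Ac i ((Real.sqrt 18)⁻¹ • intVec ![4, 4, 4])‖ ≠ 0 := by intro h; rw [h] at hL'; norm_num at hL'
  exact ⟨by rw [norm_smul, norm_inv, norm_norm, inv_mul_cancel₀ hne],
    nearestDist_pos_of_frame hy (Or.inr rfl) (fun v hv => (hf0 v hv).1) hinj0⟩

/-- ★ `walker_end` (memo §7, step 2): from an h-site `m` of the ball with chart axis `n`, the sheet walk reaches a point `z` of the local plane
(`⟪n, z − y m⟫ = 0`, `‖z − y m‖ ≤ Λ ≤ 38.28 ν_m`) along eight waypoints of the segment `[y m, z]` (parts 22D-α `waypoints`, 22B `access`), provided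
the segment and `z` lie in a ball `B(y j, R)` with `R + 6.31 ν_m ≤ ρ₁ ν_j`; the END SITE `a₀` is an h-site of the ball with scale within `0.0203 ν_m`,
axis within `0.01534` of `±n`, height `≤ 0.60003 ν_m` over the plane, lateral offset `≤ 0.64 ν_m` and distance `≤ 0.88 ν_m` to `z`
(part 22B `chain_guard` at `t ≤ 59`; `0.60003² + 0.64² ≤ 0.88²`). [this file · kind: assembly] -/
theorem walker_end {m : Fin N} (hballm : dist (y m) (y j) ≤ ρ₁ * nearestDist y j) (hPm : Pc m = hcpTwoShellPattern)
    {n : E3} (hn : n = (‖Ac m ((Real.sqrt 18)⁻¹ • intVec ![4, 4, 4])‖⁻¹ • Ac m ((Real.sqrt 18)⁻¹ • intVec ![4, 4, 4]) : E3))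
    {z : E3} {R Λ : ℝ} (hz : ⟪n, z - y m⟫_ℝ = 0) (hΛ : ‖z - y m‖ ≤ Λ) (hΛ' : Λ ≤ 957 / 25 * nearestDist y m)
    (hmR : dist (y m) (y j) ≤ R) (hzR : dist z (y j) ≤ R) (hreg : R + 631 / 100 * nearestDist y m ≤ ρ₁ * nearestDist y j) :
    ∃ a₀ : Fin N, dist (y a₀) (y j) ≤ ρ₁ * nearestDist y j ∧ Pc a₀ = hcpTwoShellPattern ∧
      |nearestDist y a₀ - nearestDist y m| ≤ 203 / 10000 * nearestDist y m ∧
      (∃ σ : ℝ, (σ = 1 ∨ σ = -1) ∧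
        ‖(‖Ac a₀ ((Real.sqrt 18)⁻¹ • intVec ![4, 4, 4])‖⁻¹ • Ac a₀ ((Real.sqrt 18)⁻¹ • intVec ![4, 4, 4]) : E3) - σ • n‖
          ≤ 1534 / 100000) ∧
      |⟪n, y a₀ - y m⟫_ℝ| ≤ 60003 / 100000 * nearestDist y m ∧
      ‖(z - y a₀) - ⟪n, z - y a₀⟫_ℝ • n‖ ≤ 16 / 25 * nearestDist y m ∧
      ‖z - y a₀‖ ≤ 22 / 25 * nearestDist y m := by
  obtain ⟨hn1, hνm⟩ := unit_axis hy hA hf hinj hex hballm hPm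
  rw [← hn] at hn1
  -- the waypoints of the segment `[y m, z]` and the access walk
  have hΛlat : ‖(z - y m) - ⟪n, z - y m⟫_ℝ • n‖ ≤ 957 / 25 * nearestDist y m :=
    (lat_norm_le hn1 _).trans (hΛ.trans hΛ')
  obtain ⟨W, hW0, hWsp, hWh, hWgap, hWseg⟩ := waypoints hνm hz hΛlat
  have hWη : ∀ i, i ≤ 8 → |⟪n, W i - y m⟫_ℝ| ≤ 0 * nearestDist y m := by
    intro i hi; rw [hWh i hi, abs_zero, zero_mul]
  have hWreg : ∀ i, i ≤ 8 → dist (W i) (y j) + (132 / 25 + 103 / 100) * nearestDist y m ≤ ρ₁ * nearestDist y j := by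
    intro i hi
    obtain ⟨θ, h0, h1, hWi⟩ := hWseg i hi
    have hd : dist (W i) (y j) ≤ R := by rw [hWi]; exact segment_dist_le h0 h1 hmR hzR
    linarith
  have hTη : |⟪n, z - y m⟫_ℝ| ≤ 0 * nearestDist y m := by rw [hz, abs_zero, zero_mul]
  have hTreg : dist z (y j) + (221 / 100 + 103 / 100) * nearestDist y m ≤ ρ₁ * nearestDist y j := by linarith
  obtain ⟨c, w, L, hL, hc0, hpre, hstep, hlat⟩ := access hy hP hA hf hinj hex hballm hPm hn W hW0 hWsp hWη
    (by norm_num) (by norm_num) hWreg z hWgap hTη (by norm_num) (by norm_num) hTreg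
  -- metrology of the end site `a₀ := c L` (part 22B `chain_guard`, `L ≤ 59`)
  have hn' : n = (‖Ac (c 0) ((Real.sqrt 18)⁻¹ • intVec ![4, 4, 4])‖⁻¹ • Ac (c 0) ((Real.sqrt 18)⁻¹ • intVec ![4, 4, 4]) : E3) := by
    rw [hc0]; exact hn
  obtain ⟨⟨σ, hσ, hax⟩, hwin, hht⟩ := chain_guard hy hA hf hinj hex (t := L) (by omega) hpre hstep hn'
  rw [hc0] at hwin hht
  have hL' : (L : ℝ) ≤ 59 := by exact_mod_cast hL
  have hL0 : (0 : ℝ) ≤ L := Nat.cast_nonneg L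
  have hwin' : |nearestDist y (c L) - nearestDist y m| ≤ 203 / 10000 * nearestDist y m := by
    refine hwin.trans ?_
    have := mul_le_mul_of_nonneg_right (show 26 / 10000 + 3 / 10000 * (L : ℝ) ≤ 203 / 10000 by linarith) hνm.le
    linarith
  have hht' : |⟪n, y (c L) - y m⟫_ℝ| ≤ 60003 / 100000 * nearestDist y m := by
    refine hht.trans ?_
    have := mul_le_mul_of_nonneg_right
      (show 13 / 100000 * (L : ℝ) ^ 2 + 25 / 10000 * L ≤ 60003 / 100000 by nlinarith) hνm.le
    linarith
  refine ⟨c L, (hpre L le_rfl).1, (hpre L le_rfl).2, hwin', ⟨σ, hσ, hax.trans (by linarith)⟩, hht', hlat, ?_⟩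
  have hh : |⟪n, z - y (c L)⟫_ℝ| ≤ 60003 / 100000 * nearestDist y m := by
    have e : ⟪n, z - y (c L)⟫_ℝ = ⟪n, z - y m⟫_ℝ - ⟪n, y (c L) - y m⟫_ℝ := by
      rw [← inner_sub_right]; congr 1; abel
    rw [e, hz, zero_sub, abs_neg]; exact hht'
  exact norm_le_of_height_of_lateral hn1 hh hlat (by positivity) (by nlinarith [hνm])

/-! ## §3 The engine -/

/-- Steps 0–2 of the engine: the in-plane two-plane point `z` of the crossing sites `ma`, `mb` (part 22D-α `two_plane_inplane`, `x := y j`)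
and the two END SITES `a₀`, `b₀` of the walkers (`walker_end`), with their metrology relative to `z`. [this file · kind: assembly] -/
theorem cross_ends {ma mb : Fin N} (hballa : dist (y ma) (y j) ≤ ρ₁ * nearestDist y j) (hPa : Pc ma = hcpTwoShellPattern)
    (hballb : dist (y mb) (y j) ≤ ρ₁ * nearestDist y j) (hPb : Pc mb = hcpTwoShellPattern) (hνj : 0 < nearestDist y j)
    {D lo hi c K M : ℝ} (hDa : dist (y ma) (y j) ≤ D * nearestDist y j) (hDb : dist (y mb) (y j) ≤ D * nearestDist y j)
    {na nb : E3} (hna : na = (‖Ac ma ((Real.sqrt 18)⁻¹ • intVec ![4, 4, 4])‖⁻¹ • Ac ma ((Real.sqrt 18)⁻¹ • intVec ![4, 4, 4]) : E3))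
    (hnb : nb = (‖Ac mb ((Real.sqrt 18)⁻¹ • intVec ![4, 4, 4])‖⁻¹ • Ac mb ((Real.sqrt 18)⁻¹ • intVec ![4, 4, 4]) : E3))
    (hc : |⟪na, nb⟫_ℝ| ≤ c) (hc' : c ≤ 87 / 250)
    (hloa : lo * nearestDist y j ≤ nearestDist y ma) (hhia : nearestDist y ma ≤ hi * nearestDist y j)
    (hlob : lo * nearestDist y j ≤ nearestDist y mb) (hhib : nearestDist y mb ≤ hi * nearestDist y j)
    (hK1 : 1 ≤ K) (hK : 2 ≤ (1 - c) * K ^ 2) (hM0 : 0 ≤ M) (hM : 1 + c ≤ (1 - c) * M ^ 2)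
    (hS1 : K * D + 671 / 100 * hi ≤ ρ₁) (hS3 : (M + 1) * D ≤ 957 / 25 * lo) :
    ∃ (z : E3) (a₀ b₀ : Fin N) (σa σb : ℝ),
      dist (y a₀) (y j) ≤ ρ₁ * nearestDist y j ∧ Pc a₀ = hcpTwoShellPattern ∧
      dist (y b₀) (y j) ≤ ρ₁ * nearestDist y j ∧ Pc b₀ = hcpTwoShellPattern ∧
      |nearestDist y a₀ - nearestDist y ma| ≤ 203 / 10000 * nearestDist y ma ∧
      |nearestDist y b₀ - nearestDist y mb| ≤ 203 / 10000 * nearestDist y mb ∧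
      (σa = 1 ∨ σa = -1) ∧
      ‖(‖Ac a₀ ((Real.sqrt 18)⁻¹ • intVec ![4, 4, 4])‖⁻¹ • Ac a₀ ((Real.sqrt 18)⁻¹ • intVec ![4, 4, 4]) : E3) - σa • na‖ ≤ 1534 / 100000 ∧
      (σb = 1 ∨ σb = -1) ∧
      ‖(‖Ac b₀ ((Real.sqrt 18)⁻¹ • intVec ![4, 4, 4])‖⁻¹ • Ac b₀ ((Real.sqrt 18)⁻¹ • intVec ![4, 4, 4]) : E3) - σb • nb‖ ≤ 1534 / 100000 ∧
      |⟪na, z - y a₀⟫_ℝ| ≤ 60003 / 100000 * nearestDist y ma ∧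
      ‖z - y a₀‖ ≤ 22 / 25 * nearestDist y ma ∧ ‖z - y b₀‖ ≤ 22 / 25 * nearestDist y mb ∧
      ‖z - y j‖ ≤ K * (D * nearestDist y j) := by
  -- step 0: unit axes, positive scales, the side conditions at scale `ν_j`
  obtain ⟨hna1, hνa⟩ := unit_axis hy hA hf hinj hex hballa hPa
  obtain ⟨hnb1, hνb⟩ := unit_axis hy hA hf hinj hex hballb hPb
  rw [← hna] at hna1; rw [← hnb] at hnb1
  have hc1 : c < 1 := by linarith only [hc']
  have hD0 : 0 ≤ D * nearestDist y j := dist_nonneg.trans hDa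
  have hS1' := mul_le_mul_of_nonneg_right hS1 hνj.le; have hS3' := mul_le_mul_of_nonneg_right hS3 hνj.le
  have hKD : D * nearestDist y j ≤ K * (D * nearestDist y j) := by
    have := mul_le_mul_of_nonneg_right hK1 hD0; linarith only [this]
  -- step 1: the in-plane two-plane point `z`
  have hxa : ‖y j - y ma‖ ≤ D * nearestDist y j := by rw [← dist_eq_norm, dist_comm]; exact hDa
  have hxb : ‖y j - y mb‖ ≤ D * nearestDist y j := by rw [← dist_eq_norm, dist_comm]; exact hDb
  have hd₁ : |⟪na, y j - y ma⟫_ℝ| ≤ D * nearestDist y j :=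
    (abs_real_inner_le_norm _ _).trans (by rw [hna1, one_mul]; exact hxa)
  have hd₂ : |⟪nb, y j - y mb⟫_ℝ| ≤ D * nearestDist y j :=
    (abs_real_inner_le_norm _ _).trans (by rw [hnb1, one_mul]; exact hxb)
  obtain ⟨z, hz1, hz2, hzx, hza, hzb⟩ :=
    two_plane_inplane hna1 hnb1 hc hc1 hd₁ hd₂ (by linarith only [hK1]) hK hM0 hM
  have hzj : dist z (y j) ≤ K * (D * nearestDist y j) := by rw [dist_eq_norm]; exact hzx
  -- step 2: both walkers access `z`; end sites `a₀`, `b₀`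
  obtain ⟨a₀, hball₀, hP₀, hwa, ⟨σa, hσa, haxa⟩, hhta, -, hza₀⟩ :=
    walker_end hy hP hA hf hinj hex hballa hPa hna hz1 hza (by linarith only [hxa, hS3', hloa]) (hDa.trans hKD) hzj
      (by linarith only [hS1', hhia, hνa])
  obtain ⟨b₀, hball₁, hP₁, hwb, ⟨σb, hσb, haxb⟩, -, -, hzb₀⟩ :=
    walker_end hy hP hA hf hinj hex hballb hPb hnb hz2 hzb (by linarith only [hxb, hS3', hlob]) (hDb.trans hKD) hzj
      (by linarith only [hS1', hhib, hνb])
  refine ⟨z, a₀, b₀, σa, σb, hball₀, hP₀, hball₁, hP₁, hwa, hwb, hσa, haxa, hσb, haxb, ?_, hza₀, hzb₀, hzx⟩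
  have e : ⟪na, z - y a₀⟫_ℝ = ⟪na, z - y ma⟫_ℝ - ⟪na, y a₀ - y ma⟫_ℝ := by
    rw [← inner_sub_right]; congr 1; abel
  rw [e, hz1, zero_sub, abs_neg]; exact hhta

/-- Steps 3–7 of the engine: from the end sites `a₀`, `b₀` near the common point `z` (scales `νa`, `νb` of the crossing sites) — the local frame
`(±N(a₀), y a₀)`, the steep straddle at `b₀` (part 22C), the net sites under it (part 22D-α), and TREE `crossing_pair_absurd`.
[this file · kind: assembly] -/
theorem cross_engine {a₀ b₀ : Fin N} (hball₀ : dist (y a₀) (y j) ≤ ρ₁ * nearestDist y j) (hP₀ : Pc a₀ = hcpTwoShellPattern)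
    (hball₁ : dist (y b₀) (y j) ≤ ρ₁ * nearestDist y j) (hP₁ : Pc b₀ = hcpTwoShellPattern) (hνj : 0 < nearestDist y j)
    {na nb z : E3} {νa νb D lo hi c K : ℝ} (hna1 : ‖na‖ = 1) (hc : |⟪na, nb⟫_ℝ| ≤ c) (hc' : c ≤ 87 / 250)
    (hwa : |nearestDist y a₀ - νa| ≤ 203 / 10000 * νa) (hwb : |nearestDist y b₀ - νb| ≤ 203 / 10000 * νb)
    {σa σb : ℝ} (hσa : σa = 1 ∨ σa = -1)
    (haxa : ‖(‖Ac a₀ ((Real.sqrt 18)⁻¹ • intVec ![4, 4, 4])‖⁻¹ • Ac a₀ ((Real.sqrt 18)⁻¹ • intVec ![4, 4, 4]) : E3) - σa • na‖ ≤ 1534 / 100000)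
    (hσb : σb = 1 ∨ σb = -1)
    (haxb : ‖(‖Ac b₀ ((Real.sqrt 18)⁻¹ • intVec ![4, 4, 4])‖⁻¹ • Ac b₀ ((Real.sqrt 18)⁻¹ • intVec ![4, 4, 4]) : E3) - σb • nb‖ ≤ 1534 / 100000)
    (hhza : |⟪na, z - y a₀⟫_ℝ| ≤ 60003 / 100000 * νa) (hza₀ : ‖z - y a₀‖ ≤ 22 / 25 * νa) (hzb₀ : ‖z - y b₀‖ ≤ 22 / 25 * νb)
    (hzx : ‖z - y j‖ ≤ K * (D * nearestDist y j))
    (hloa : lo * nearestDist y j ≤ νa) (hhia : νa ≤ hi * nearestDist y j) (hlob : lo * nearestDist y j ≤ νb)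
    (hhib : νb ≤ hi * nearestDist y j) (hνa : 0 < νa) (hνb : 0 < νb)
    (hS1 : K * D + 671 / 100 * hi ≤ ρ₁) (hS2 : hi ≤ 27 / 20 * lo) : False := by
  have hS1' := mul_le_mul_of_nonneg_right hS1 hνj.le; have hS2' := mul_le_mul_of_nonneg_right hS2 hνj.le
  obtain ⟨hwa1, hwa2⟩ := abs_le.1 hwa
  obtain ⟨hwb1, hwb2⟩ := abs_le.1 hwb
  -- step 3: the local frame `(n, q₀ := y a₀)`, `n′ := ±n` pointing away from `b₀`
  obtain ⟨hn1, hν₀⟩ := unit_axis hy hA hf hinj hex hball₀ hP₀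
  obtain ⟨hnB1, hν₁⟩ := unit_axis hy hA hf hinj hex hball₁ hP₁
  set n : E3 := (‖Ac a₀ ((Real.sqrt 18)⁻¹ • intVec ![4, 4, 4])‖⁻¹ • Ac a₀ ((Real.sqrt 18)⁻¹ • intVec ![4, 4, 4]) : E3) with hndef
  set nB : E3 := (‖Ac b₀ ((Real.sqrt 18)⁻¹ • intVec ![4, 4, 4])‖⁻¹ • Ac b₀ ((Real.sqrt 18)⁻¹ • intVec ![4, 4, 4]) : E3) with hnBdef
  have htilt : |⟪n, nB⟫_ℝ| ≤ 379 / 1000 := (inner_near_axes hna1 hnB1 hσa hσb haxa haxb hc).trans (by linarith only [hc'])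
  obtain ⟨s, hs, hh0⟩ : ∃ s : ℝ, (s = 1 ∨ s = -1) ∧ ⟪s • n, y b₀ - y a₀⟫_ℝ ≤ 0 := by
    by_cases h : ⟪n, y b₀ - y a₀⟫_ℝ ≤ 0
    · exact ⟨1, Or.inl rfl, by rwa [one_smul]⟩
    · exact ⟨-1, Or.inr rfl, by rw [neg_one_smul, inner_neg_left]; linarith only [not_le.1 h]⟩
  set n' : E3 := s • n with hn'def
  have hn'1 : ‖n'‖ = 1 := by rw [hn'def, norm_sign_smul hs, hn1]
  have hab₀ : ‖y b₀ - y a₀‖ ≤ 22 / 25 * νa + 22 / 25 * νb := by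
    rw [show y b₀ - y a₀ = (z - y a₀) - (z - y b₀) by abel]; exact (norm_sub_le _ _).trans (add_le_add hza₀ hzb₀)
  have hh1 : -(59 / 25) * nearestDist y b₀ < ⟪n', y b₀ - y a₀⟫_ℝ := by
    have h1 : |⟪n', y b₀ - y a₀⟫_ℝ| ≤ ‖y b₀ - y a₀‖ :=
      (abs_real_inner_le_norm _ _).trans (by rw [hn'1, one_mul])
    have h2 := (abs_le.1 (h1.trans hab₀)).1
    linarith only [h2, hhia, hS2', hlob, hwb1, hνb]
  -- step 4: the steep straddle at `b₀`
  have hdb₀ : dist (y b₀) (y j) ≤ K * (D * nearestDist y j) + 22 / 25 * νb := by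
    rw [dist_eq_norm, show y b₀ - y j = (z - y j) - (z - y b₀) by abel]; exact (norm_sub_le _ _).trans (add_le_add hzx hzb₀)
  have hregb : dist (y b₀) (y j) + 303 / 100 * nearestDist y b₀ ≤ ρ₁ * nearestDist y j := by
    linarith only [hdb₀, hwb2, hhib, hνb, hS1']
  have htilt' : |⟪n', nB⟫_ℝ| ≤ 379 / 1000 := by rw [hn'def, abs_inner_sign hs]; exact htilt
  obtain ⟨cb, wb, hcb0, hAll, hBll, -, hRise, i, hi, hbi, hbi'⟩ :=
    steep_straddle hy hP hA hf hinj hex hball₁ hP₁ hregb hn'1 htilt' (y a₀) hh0 hh1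
  -- step 4': metrology of the straddle sites (part 22B `chain_guard` at `t ≤ 3`) and their lateral drift
  have hnB' : nB = (‖Ac (cb 0) ((Real.sqrt 18)⁻¹ • intVec ![4, 4, 4])‖⁻¹ • Ac (cb 0) ((Real.sqrt 18)⁻¹ • intVec ![4, 4, 4]) : E3) := by rw [hnBdef, hcb0]
  have hguard : ∀ t, t ≤ 3 →
      (∃ σ' : ℝ, (σ' = 1 ∨ σ' = -1) ∧
        ‖(‖Ac (cb t) ((Real.sqrt 18)⁻¹ • intVec ![4, 4, 4])‖⁻¹ • Ac (cb t) ((Real.sqrt 18)⁻¹ • intVec ![4, 4, 4]) : E3) - σ' • nB‖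
          ≤ 26 / 100000 * t) ∧
      |nearestDist y (cb t) - nearestDist y b₀| ≤ (26 / 10000 + 3 / 10000 * t) * nearestDist y b₀ := by
    intro t ht
    obtain ⟨hax, hwin, -⟩ := chain_guard hy hA hf hinj hex (t := t) (by omega) (fun t' ht' => hAll t' (by omega))
      (fun t' ht' => hBll t' (by omega)) hnB'
    rw [hcb0] at hwin; exact ⟨hax, hwin⟩
  have hwint : ∀ t, t ≤ 3 → nearestDist y (cb t) ≤ 10035 / 10000 * nearestDist y b₀ := by
    intro t ht
    have h := (abs_le.1 (hguard t ht).2).2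
    have ht' : (t : ℝ) ≤ 3 := by exact_mod_cast ht
    linarith only [h, mul_le_mul_of_nonneg_right (show 26 / 10000 + 3 / 10000 * (t : ℝ) ≤ 35 / 10000 by linarith only [ht']) hν₁.le]
  have hdrift := drift_sum hn'1 (fun t => y (cb t)) (fun t => nearestDist y (cb t)) (ν₀ := nearestDist y b₀) hν₁.le
    (fun t ht => ⟨nearestDist_nonneg y (cb t), hwint t (by omega)⟩) (fun t ht => ⟨(hRise t ht).1, (hRise t ht).2.1⟩)
  -- step 5: the projected targets `V q` and the net sites under the straddle (part 22D-α `net_site`, `η = 0`, `E = 2.21`)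
  obtain ⟨V, hV⟩ : ∃ V : ℕ → E3, ∀ q, V q = y (cb q) - ⟪n, y (cb q) - y a₀⟫_ℝ • n := ⟨_, fun q => rfl⟩
  have eVa : ∀ (q) (X : E3), V q - X = (y (cb q) - X) - ⟪n, y (cb q) - y a₀⟫_ℝ • n := fun q X => by rw [hV]; abel
  have eVV : ∀ q, V (q + 1) - V q
      = (y (cb (q + 1)) - y (cb q)) - (⟪n, y (cb (q + 1)) - y a₀⟫_ℝ - ⟪n, y (cb q) - y a₀⟫_ℝ) • n := fun q => by
    rw [hV, hV, sub_smul]; abel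
  have hnn : ⟪n, n⟫_ℝ = 1 := by rw [real_inner_self_eq_norm_sq, hn1]; norm_num
  have hnsm : ∀ h : ℝ, ‖h • n‖ = |h| := fun h => by rw [norm_smul, hn1, mul_one, Real.norm_eq_abs]
  have hV0 : ‖(V 0 - y a₀) - ⟪n, V 0 - y a₀⟫_ℝ • n‖ ≤ 53 / 25 * nearestDist y a₀ := by
    rw [eVa, lat_axis_shift hn1, hcb0]
    refine (lat_norm_le hn1 _).trans (hab₀.trans ?_)
    linarith only [hwa1, hhib, hS2', hloa, hνa]
  have hVsp : ∀ q, q < 3 → ‖(V (q + 1) - V q) - ⟪n, V (q + 1) - V q⟫_ℝ • n‖ ≤ 37 / 25 * nearestDist y a₀ := by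
    intro q hq
    rw [eVV, lat_axis_shift hn1, ← lat_sign hs (y (cb (q + 1)) - y (cb q))]
    obtain ⟨hr, hl, -⟩ := hRise q hq
    refine (lat_le_of_rise hn'1 (nearestDist_nonneg y (cb q)) hr hl).trans ?_
    linarith only [hwint q (by omega), hwb2, hhib, hS2', hloa, hwa1, hνa]
  have hVη : ∀ q, q ≤ 3 → |⟪n, V q - y a₀⟫_ℝ| ≤ 0 * nearestDist y a₀ := by
    intro q _
    have h0 : ⟪n, V q - y a₀⟫_ℝ = 0 := by
      rw [eVa, inner_sub_right, real_inner_smul_right, hnn, mul_one, sub_self]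
    rw [h0, abs_zero, zero_mul]
  have hh : |⟪n, z - y a₀⟫_ℝ| ≤ 61353 / 100000 * νa := by
    have h1 := inner_step (s := z - y a₀) hσa (axis_flip hσa haxa)
    have h2 : 1534 / 100000 * ‖z - y a₀‖ ≤ 1534 / 100000 * (22 / 25 * νa) := by gcongr
    linarith only [h1, h2, hhza, hνa]
  have hVreg : ∀ q, q ≤ 3 → dist (V q) (y j) + (221 / 100 + 103 / 100) * nearestDist y a₀ ≤ ρ₁ * nearestDist y j := by
    intro q hq
    have hd := hdrift q hq; rw [hcb0] at hd
    have hsplit : ⟪n, y (cb q) - y a₀⟫_ℝ = ⟪n, z - y a₀⟫_ℝ + ⟪n, y b₀ - z⟫_ℝ + ⟪n, y (cb q) - y b₀⟫_ℝ := by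
      rw [← inner_add_right, ← inner_add_right]; congr 1; abel
    have e : V q - y j = ((z - y j) - ⟪n, z - y a₀⟫_ℝ • n) + ((y b₀ - z) - ⟪n, y b₀ - z⟫_ℝ • n)
        + ((y (cb q) - y b₀) - ⟪n, y (cb q) - y b₀⟫_ℝ • n) := by
      rw [hV, hsplit, add_smul, add_smul]; abel
    have hq' : (q : ℝ) ≤ 3 := by exact_mod_cast hq
    have hB : ‖(y b₀ - z) - ⟪n, y b₀ - z⟫_ℝ • n‖ ≤ 22 / 25 * νb :=
      (lat_norm_le hn1 _).trans (by rw [norm_sub_rev]; exact hzb₀)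
    have hC : ‖(y (cb q) - y b₀) - ⟪n, y (cb q) - y b₀⟫_ℝ • n‖ ≤ 6222 / 10000 * q * nearestDist y b₀ := by
      rw [← lat_sign hs]; exact hd
    have hdist : dist (V q) (y j) ≤ K * (D * nearestDist y j) + 61353 / 100000 * νa
        + 22 / 25 * νb + 6222 / 10000 * q * nearestDist y b₀ := by
      rw [dist_eq_norm, e]
      refine (norm_add_le _ _).trans ?_
      refine (add_le_add (norm_add_le _ _) le_rfl).trans ?_
      refine (add_le_add (add_le_add (norm_sub_le _ _) le_rfl) le_rfl).trans ?_
      rw [hnsm]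
      linarith only [hzx, hh, hB, hC]
    have h3q := mul_le_mul_of_nonneg_right (show 6222 / 10000 * (q : ℝ) ≤ 18666 / 10000 by linarith only [hq']) hν₁.le
    linarith only [hdist, h3q, hS1', hwb2, hwa2, hhia, hhib, hνa, hνb]
  have hnet := net_site hy hP hA hf hinj hex hball₀ hP₀ hndef V hV0 hVsp hVη (by norm_num) (by norm_num) hVreg
  -- step 6: the net sites under `cb i`, `cb (i+1)`; they are not straddle sites (axes apart)
  obtain ⟨a, -, -, hνa', hafl, halat, σ₁, hσ₁, hax₁⟩ := hnet i (by omega)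
  obtain ⟨a', -, -, hνa'', hafl', halat', σ₁', hσ₁', hax₁'⟩ := hnet (i + 1) (by omega)
  have hne : ∀ {t : ℕ}, t ≤ 3 → ∀ {e : Fin N} {σ₀ : ℝ}, (σ₀ = 1 ∨ σ₀ = -1) →
      ‖(‖Ac e ((Real.sqrt 18)⁻¹ • intVec ![4, 4, 4])‖⁻¹ • Ac e ((Real.sqrt 18)⁻¹ • intVec ![4, 4, 4]) : E3) - σ₀ • n‖ ≤ 1 / 250 → e ≠ cb t := by
    intro t ht e σ₀ hσ₀ hax₀ h
    obtain ⟨⟨σ', hσ', hax'⟩, -⟩ := hguard t ht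
    rw [← h] at hax'
    have ht' : (t : ℝ) ≤ 3 := by exact_mod_cast ht
    have hge := axes_apart hn1 hnB1 hσ₀ hσ' hax₀
      (hax'.trans (show 26 / 100000 * (t : ℝ) ≤ 78 / 100000 by linarith only [ht']))
    norm_num at hge
    linarith only [hge, htilt]
  have hab : a ≠ cb i := hne (by omega) hσ₁ hax₁; have hab' : a' ≠ cb (i + 1) := hne (by omega) hσ₁' hax₁'
  -- step 7: heights and laterals in the frame `n′`, and the tree's `crossing_pair_absurd`
  have ha : |⟪n', y a - y a₀⟫_ℝ| ≤ 1 / 10 * nearestDist y a := by rw [hn'def, abs_inner_sign hs]; exact hafl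
  have ha' : |⟪n', y a' - y a₀⟫_ℝ| ≤ 1 / 10 * nearestDist y a' := by rw [hn'def, abs_inner_sign hs]; exact hafl'
  have hlat : ‖(y (cb i) - y a) - ⟪n', y (cb i) - y a⟫_ℝ • n'‖ ≤ 3 / 4 * nearestDist y a := by
    have h := halat; rw [eVa, lat_axis_shift hn1] at h; rwa [hn'def, lat_sign hs]
  have hlat' : ‖(y (cb (i + 1)) - y a') - ⟪n', y (cb (i + 1)) - y a'⟫_ℝ • n'‖ ≤ 3 / 4 * nearestDist y a' := by
    have h := halat'; rw [eVa, lat_axis_shift hn1] at h; rwa [hn'def, lat_sign hs]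
  obtain ⟨-, hl, hl'⟩ := hRise i (by omega)
  have hlam : dist (y (cb i)) (y (cb (i + 1))) ≤ 10011 / 10000 * nearestDist y (cb i) := by
    rw [dist_comm, dist_eq_norm]; exact hl
  have hlam' : dist (y (cb i)) (y (cb (i + 1))) ≤ 10011 / 10000 * nearestDist y (cb (i + 1)) := by
    rw [dist_comm, dist_eq_norm]; exact hl'
  have hst : ⟪n', y (cb (i + 1)) - y a₀⟫_ℝ - ⟪n', y (cb i) - y a₀⟫_ℝ ≤ 1 * dist (y (cb i)) (y (cb (i + 1))) := by
    have e : ⟪n', y (cb (i + 1)) - y a₀⟫_ℝ - ⟪n', y (cb i) - y a₀⟫_ℝ = ⟪n', y (cb (i + 1)) - y (cb i)⟫_ℝ := by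
      rw [← inner_sub_right]; congr 1; abel
    rw [e, one_mul, dist_comm, dist_eq_norm]
    exact (real_inner_le_norm _ _).trans (by rw [hn'1, one_mul])
  exact crossing_pair_absurd hn'1 (σ := 1) (lam := 10011 / 10000) (ε := 1 / 10) (κ := 3 / 4)
    (by norm_num) (by norm_num) (by norm_num) (by norm_num) hbi hbi' hst hlam hlam' hab hνa' ha hlat hab' hνa'' ha' hlat'

/-- ★★ `no_crossing` — THE POINTWISE CROSSING-EXCLUSION ENGINE (memo §7, steps 0–7; see the module docstring): two h-sites `ma`, `mb` of the ball,
both within `D ν_j` of the centre, with scales in `[lo ν_j, hi ν_j]` and chart axes `na`, `nb` crossing at `|⟪na, nb⟫| ≤ c ≤ 87/250`, contradict the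
chart datum under the side conditions `K D + 6.71 hi ≤ ρ₁`, `hi ≤ 1.35 lo`, `(M + 1) D ≤ 38.28 lo`, `1 ≤ K`, `(1 − c) K² ≥ 2`, `0 ≤ M`,
`(1 − c) M² ≥ 1 + c`.  (Record: `D = 13`, `ρ₁ = 30`, `lo = 0.888`, `hi = 1.04`, `c = 103/300`, `K = 1.746`, `M = 1.44`.) [this file · kind: engine] -/
theorem no_crossing {ma mb : Fin N} (hballa : dist (y ma) (y j) ≤ ρ₁ * nearestDist y j) (hPa : Pc ma = hcpTwoShellPattern)
    (hballb : dist (y mb) (y j) ≤ ρ₁ * nearestDist y j) (hPb : Pc mb = hcpTwoShellPattern) (hνj : 0 < nearestDist y j)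
    {D lo hi c K M : ℝ} (hDa : dist (y ma) (y j) ≤ D * nearestDist y j) (hDb : dist (y mb) (y j) ≤ D * nearestDist y j)
    {na nb : E3} (hna : na = (‖Ac ma ((Real.sqrt 18)⁻¹ • intVec ![4, 4, 4])‖⁻¹ • Ac ma ((Real.sqrt 18)⁻¹ • intVec ![4, 4, 4]) : E3))
    (hnb : nb = (‖Ac mb ((Real.sqrt 18)⁻¹ • intVec ![4, 4, 4])‖⁻¹ • Ac mb ((Real.sqrt 18)⁻¹ • intVec ![4, 4, 4]) : E3))
    (hc : |⟪na, nb⟫_ℝ| ≤ c) (hc' : c ≤ 87 / 250)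
    (hloa : lo * nearestDist y j ≤ nearestDist y ma) (hhia : nearestDist y ma ≤ hi * nearestDist y j)
    (hlob : lo * nearestDist y j ≤ nearestDist y mb) (hhib : nearestDist y mb ≤ hi * nearestDist y j)
    (hK1 : 1 ≤ K) (hK : 2 ≤ (1 - c) * K ^ 2) (hM0 : 0 ≤ M) (hM : 1 + c ≤ (1 - c) * M ^ 2)
    (hS1 : K * D + 671 / 100 * hi ≤ ρ₁) (hS2 : hi ≤ 27 / 20 * lo) (hS3 : (M + 1) * D ≤ 957 / 25 * lo) : False := by
  obtain ⟨z, a₀, b₀, σa, σb, hball₀, hP₀, hball₁, hP₁, hwa, hwb, hσa, haxa, hσb, haxb, hhza, hza₀, hzb₀, hzx⟩ :=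
    cross_ends hy hP hA hf hinj hex hballa hPa hballb hPb hνj hDa hDb hna hnb hc hc' hloa hhia hlob hhib hK1 hK hM0 hM hS1 hS3
  obtain ⟨hna1, hνa⟩ := unit_axis hy hA hf hinj hex hballa hPa; rw [← hna] at hna1
  obtain ⟨-, hνb⟩ := unit_axis hy hA hf hinj hex hballb hPb
  exact cross_engine hy hP hA hf hinj hex hball₀ hP₀ hball₁ hP₁ hνj hna1 hc hc' hwa hwb hσa haxa hσb haxb hhza hza₀ hzb₀ hzx
    hloa hhia hlob hhib hνa hνb hS1 hS2

end Atlas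
end Summit.AtomisticToContinuum.Crystallization.Theorems.OverbindingBudgetAffineRunCutSheetCrossing
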